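import Literature.NumberTheory.EllipticCurves.DiscreteH1Equiv
import Literature.NumberTheory.EllipticCurves.ZpExtensionGaloisTwistPrimaryProofs
import Literature.NumberTheory.EllipticCurves.QuadraticTwistSelmerPInfty
import Literature.NumberTheory.EllipticCurves.IwasawaSelmerProofs
import HarnessLib

/-!
# `Sel_{p^∞}(E/L)` over `L = K̄^H` along an isomorphism of geometric points which is Galois-equivariant UP TO A
# SIGN trivial on `H` (Greenberg's «as `G_{F_∞}`-modules `A_s = A`», LNM 1716 §4 p. 107; Silverman X.§4)

For two Weierstrass curves `W, W′` over `K` and an additive isomorphism of geometric points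
`e : W′(K̄) ≃+ W(K̄)` with `e(σP) = χ(σ)·σ·e(P)` for a sign `χ : Γ_K → {±1}` TRIVIAL ON A SUBGROUP `H ≤ Γ_K`
(`χ = 1`: `W′ = V • W` is `K`-isomorphic to `W`; `χ` the quadratic character of `K(√d)/K` and `H ≤ Γ_{K(√d)}`:
`W′ ≅ W^{(d)}`, file `QuadraticTwistSelmerInftyProofs`), this file proves:

* `primaryComponentCongr_smul`, `coeffH1Equiv` — `e` restricts to an `H`-equivariant isomorphism
  `W′[p^∞] ≃+ W[p^∞]`, whence `Ψ_e : H¹(H, W′[p^∞]) ≃+ H¹(H, W[p^∞])` (the tree's `h1Equiv` over the group `H`;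
  Greenberg: `H¹(F_∞, A_s) = H¹(F_∞, A)`);
* **`coeffH1Equiv_conjH1`** — `Ψ_e ∘ conj_σ = χ(σ) · conj_σ ∘ Ψ_e` for every `σ ∈ Γ_K` (Greenberg: «the action of
  `Γ` changes in a simple way»; the tree's `subgroupH1Congr_conjH1_eq_zsmul_const`);
* **`mem_localKerOver_iff_coeffH1Equiv_mem`** — the local Selmer condition at a `K`-field `E` corresponds under
  `Ψ_e`, GIVEN a companion isomorphism of local points `e_E : W′(Ē) ≃+ W(Ē)` equivariant for the `τ ∈ Γ_E`
  restricting into `H` and the square `pointsMap ∘ e = e_E ∘ pointsMap` (`mem_resKer_iff_h1Equiv_mem`);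
* **`mem_selmerGroupOver_iff_coeffH1Equiv_mem`** — hence `Sel_{p^∞}(W′/L) ≅ Sel_{p^∞}(W/L)` under `Ψ_e`
  (`L = K̄^H`, `H` normal; the conjugates `conj_σ` permuting the local conditions pick up only the sign `χ(σ)`);
* the case `χ = 1`, `W′ = W₁`, `W = V • W₁` (`K`-isomorphic curves), with the tree's `twistPointsIso` /
  `twistLocalIso` / `pointsMap_twistPointsIso`: **`mem_selmerGroupOver_iff_of_variableChange`** — the Selmer group
  over ANY `L = K̄^H` (e.g. `K_∞`) is an invariant of the `K`-isomorphism class (the tree had this over `K` only: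
  `mem_selmerGroupPInfty_iff_h1PrimaryIso_mem`).

One definition with body (`coeffH1Equiv`, a specialisation of `h1Equiv`) and theorems; no named fact, no instance,
no `sorry`.

References: [GreenbergLNM1716] R. Greenberg, LNM 1716 (1999), §4 p. 107; [SilvermanAEC2009] J. H. Silverman, *AEC*,
X.2 Prop. 2.4, X.§4; [SerreGaloisCohomology1997] J.-P. Serre, *Galois Cohomology*, I §2.4, I §5.3.
-/

noncomputable section

open scoped Classical

universe u

namespace Literature.NumberTheory.EllipticCurves

namespace CoeffTwist

open WeierstrassCurve NumberField IsDedekindDomain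

/-! ## §1 The `H`-equivariant isomorphism of `p`-primary torsion and `Ψ_e` on `H¹(H, ·)` -/

section H1

variable {K : Type u} [Field K] {W W' : WeierstrassCurve K} (p : ℕ)
  (H : Subgroup (Field.absoluteGaloisGroup K)) (e : geomPoints W' ≃+ geomPoints W)
  (χ : Field.absoluteGaloisGroup K → ℤ)
  (he : ∀ (σ : Field.absoluteGaloisGroup K) (P : geomPoints W'), e (σ • P) = χ σ • σ • e P)
  (hχH : ∀ σ : Field.absoluteGaloisGroup K, σ ∈ H → χ σ = 1)

include he in
/-- On `p`-primary torsion: `e(σ t) = χ(σ) · σ · e(t)`. [cite: GreenbergLNM1716, §4 p. 107] -/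
theorem primaryComponentCongr_smul (σ : Field.absoluteGaloisGroup K) (t : geomPrimaryTorsion W' p) :
    primaryComponentCongr e p (σ • t) = χ σ • σ • primaryComponentCongr e p t :=
  Subtype.ext (by
    rw [coe_primaryComponentCongr, primaryComponent.coe_smul, AddSubgroupClass.coe_zsmul,
      primaryComponent.coe_smul, coe_primaryComponentCongr, he])

include he hχH in
/-- **`e` is `H`-equivariant on `p`-primary torsion** (`χ|_H = 1`): Greenberg's «as `G_{F_∞}`-modules `A_s = A`».
[cite: GreenbergLNM1716, §4 p. 107] -/
theorem primaryComponentCongr_smul_subgroup (g : H) (t : geomPrimaryTorsion W' p) :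
    primaryComponentCongr e p (g • t) = g • primaryComponentCongr e p t := by
  rw [Subgroup.smul_def, Subgroup.smul_def, primaryComponentCongr_smul p e χ he, hχH _ g.2, one_zsmul]

/-- **`Ψ_e : H¹(H, W′[p^∞]) ≃+ H¹(H, W[p^∞])`** — the isomorphism of `H¹` along the `H`-equivariant isomorphism of
coefficients `W′[p^∞] ≃+ W[p^∞]` (the tree's `h1Equiv` over the group `H`; Greenberg: `H¹(F_∞, A_s) = H¹(F_∞, A)`).
[cite: GreenbergLNM1716, §4 p. 107] -/
def coeffH1Equiv : W'.subgroupH1 p H ≃+ W.subgroupH1 p H :=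
  h1Equiv (G := H) (primaryComponentCongr e p) (primaryComponentCongr_smul_subgroup p H e χ he hχH)

/-- `Ψ_e` is the tree's `subgroupH1Congr` (both are `resH1Hom (id_H, e)`, the map of `H¹` along a compatible pair).
[cite: SerreGaloisCohomology1997, I §2.4] -/
theorem coeffH1Equiv_eq_subgroupH1Congr (x : W'.subgroupH1 p H) :
    coeffH1Equiv p H e χ he hχH x =
      subgroupH1Congr H (primaryComponentCongr e p)
        (fun g t ↦ primaryComponentCongr_smul_subgroup p H e χ he hχH g t) x :=
  rfl

include he in
/-- **How `conj_σ` transforms under `Ψ_e`: `Ψ_e (conj_σ x) = χ(σ) · conj_σ (Ψ_e x)`** for every `σ ∈ Γ_K` (`H`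
normal) — Greenberg: on `H¹(F_∞, A_s) = H¹(F_∞, A)` «the action of `Γ` changes in a simple way», here by the sign
`χ(σ)` (the tree's `subgroupH1Congr_conjH1_eq_zsmul_const`). [cite: GreenbergLNM1716, §4 p. 107]
[cite: SerreGaloisCohomology1997, I §5.3] -/
theorem coeffH1Equiv_conjH1 [H.Normal] (σ : Field.absoluteGaloisGroup K) (x : W'.subgroupH1 p H) :
    coeffH1Equiv p H e χ he hχH (W'.conjH1 p H σ x) = χ σ • W.conjH1 p H σ (coeffH1Equiv p H e χ he hχH x) := by
  rw [coeffH1Equiv_eq_subgroupH1Congr, coeffH1Equiv_eq_subgroupH1Congr]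
  exact subgroupH1Congr_conjH1_eq_zsmul_const H (primaryComponentCongr e p) _ σ (χ σ)
    (fun t ↦ by rw [primaryComponentCongr_smul p e χ he]) x

include he in
/-- With `χ² = 1` the rule also reads `conj_σ (Ψ_e x) = χ(σ) · Ψ_e (conj_σ x)`. [cite: GreenbergLNM1716, §4 p. 107] -/
theorem conjH1_coeffH1Equiv [H.Normal] (hχ : ∀ σ, χ σ = 1 ∨ χ σ = -1) (σ : Field.absoluteGaloisGroup K)
    (x : W'.subgroupH1 p H) :
    W.conjH1 p H σ (coeffH1Equiv p H e χ he hχH x) = χ σ • coeffH1Equiv p H e χ he hχH (W'.conjH1 p H σ x) := by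
  rw [coeffH1Equiv_conjH1 p H e χ he hχH σ x, smul_smul]
  rcases hχ σ with h | h <;> simp [h]

end H1

/-! ## §2 The local condition at a `K`-field `E` -/

section Local

variable {K : Type u} [Field K] {W W' : WeierstrassCurve K} (p : ℕ)
  (H : Subgroup (Field.absoluteGaloisGroup K)) (e : geomPoints W' ≃+ geomPoints W)
  (χ : Field.absoluteGaloisGroup K → ℤ)
  (he : ∀ (σ : Field.absoluteGaloisGroup K) (P : geomPoints W'), e (σ • P) = χ σ • σ • e P)
  (hχH : ∀ σ : Field.absoluteGaloisGroup K, σ ∈ H → χ σ = 1)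
  (E : Type u) [Field E] [Algebra K E] (eE : localPoints W' E ≃+ localPoints W E)
  (heE : ∀ (τ : Field.absoluteGaloisGroup E), resGal (K := K) E τ ∈ H →
    ∀ Q : localPoints W' E, eE (τ • Q) = τ • eE Q)
  (hsq : ∀ P : geomPoints W', pointsMap W E (e P) = eE (pointsMap W' E P))

include heE hsq in
/-- **The local Selmer condition corresponds under `Ψ_e`**: given an isomorphism of local points `e_E : W′(Ē) ≃+ W(Ē)`
equivariant for the `τ ∈ Γ_E` restricting into `H` and compatible with `e` along `pointsMap : E(K̄) → E(Ē)`, a class of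
`H¹(H, W′[p^∞])` dies in `H¹(H_E, W′(Ē))` iff its image under `Ψ_e` dies in `H¹(H_E, W(Ē))` (the tree's
`mem_resKer_iff_h1Equiv_mem` for the group `H`, `φ = resGalSubgroup H E`). [cite: SilvermanAEC2009, X.§4]
[cite: SerreGaloisCohomology1997, I §2.4] -/
theorem mem_localKerOver_iff_coeffH1Equiv_mem (x : W'.subgroupH1 p H) :
    x ∈ W'.localKerOver p H E ↔ coeffH1Equiv p H e χ he hχH x ∈ W.localKerOver p H E :=
  mem_resKer_iff_h1Equiv_mem (G := H) (resGalSubgroup H E)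
    ((pointsMap W' E).comp (geomPrimaryTorsion W' p).subtype) _
    ((pointsMap W E).comp (geomPrimaryTorsion W p).subtype) _
    (primaryComponentCongr e p) (primaryComponentCongr_smul_subgroup p H e χ he hχH) eE
    (fun τ Q ↦ by rw [Subgroup.smul_def, Subgroup.smul_def]; exact heE τ τ.2 Q)
    (fun t ↦ by
      simp only [AddMonoidHom.coe_comp, AddSubgroup.coe_subtype, Function.comp_apply, coe_primaryComponentCongr]
      exact hsq t) x

end Local

/-! ## §3 The Selmer group over `L = K̄^H` -/

section Selmer

variable {K : Type u} [Field K] [NumberField K] {W W' : WeierstrassCurve K} (p : ℕ)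
  (H : Subgroup (Field.absoluteGaloisGroup K)) [H.Normal] (e : geomPoints W' ≃+ geomPoints W)
  (χ : Field.absoluteGaloisGroup K → ℤ)
  (he : ∀ (σ : Field.absoluteGaloisGroup K) (P : geomPoints W'), e (σ • P) = χ σ • σ • e P)
  (hχH : ∀ σ : Field.absoluteGaloisGroup K, σ ∈ H → χ σ = 1) (hχ : ∀ σ, χ σ = 1 ∨ χ σ = -1)
  (hfin : ∀ (v : HeightOneSpectrum (𝓞 K)) (x : W'.subgroupH1 p H),
    x ∈ W'.localKerOver p H (v.adicCompletion K) ↔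
      coeffH1Equiv p H e χ he hχH x ∈ W.localKerOver p H (v.adicCompletion K))
  (hinf : ∀ (w : InfinitePlace K) (x : W'.subgroupH1 p H),
    x ∈ W'.localKerOver p H w.Completion ↔ coeffH1Equiv p H e χ he hχH x ∈ W.localKerOver p H w.Completion)

/-- A subgroup contains `±y` iff it contains `y`. [folklore] -/
private theorem sign_zsmul_mem_iff {A : Type*} [AddCommGroup A] (S : AddSubgroup A) {c : ℤ}
    (hc : c = 1 ∨ c = -1) (y : A) : c • y ∈ S ↔ y ∈ S := by
  rcases hc with rfl | rfl
  · rw [one_zsmul]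
  · rw [neg_one_zsmul, neg_mem_iff]

include hχ hfin hinf in
/-- **`Sel_{p^∞}(W′/L) ≅ Sel_{p^∞}(W/L)` under `Ψ_e`, `L = K̄^H`**: if the local conditions correspond at every
completion of `K` (`hfin`, `hinf` — supplied by `mem_localKerOver_iff_coeffH1Equiv_mem`), then a class of
`H¹(H, W′[p^∞])` is Selmer iff its image is: the defining family `conj_σ c ∈ ker_v` (all `σ ∈ Γ_K`, all places) is
respected because `conj_σ Ψ_e = χ(σ) Ψ_e conj_σ` and the local kernels are subgroups (`±`). Greenberg, §4 p. 107:
«`Sel_E(F_∞)_p` … `H¹(F_∞, A_s) = H¹(F_∞, A)`»; Silverman X.§4 (Selmer groups are attached to `E/K`, not to an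
equation). [cite: GreenbergLNM1716, §4 p. 107] [cite: SilvermanAEC2009, X.§4] -/
theorem mem_selmerGroupOver_iff_coeffH1Equiv_mem (x : W'.subgroupH1 p H) :
    x ∈ W'.selmerGroupOver p H ↔ coeffH1Equiv p H e χ he hχH x ∈ W.selmerGroupOver p H := by
  rw [mem_selmerGroupOver_iff, mem_selmerGroupOver_iff]
  refine and_congr (forall_congr' fun v ↦ forall_congr' fun σ ↦ ?_) (forall_congr' fun w ↦ forall_congr' fun σ ↦ ?_)
  · rw [hfin v, coeffH1Equiv_conjH1 p H e χ he hχH σ x, sign_zsmul_mem_iff _ (hχ σ)]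
  · rw [hinf w, coeffH1Equiv_conjH1 p H e χ he hχH σ x, sign_zsmul_mem_iff _ (hχ σ)]

include hχ hfin hinf in
/-- The same for the inverse: `y ∈ Sel(W/L) ↔ Ψ_e⁻¹ y ∈ Sel(W′/L)`. [cite: GreenbergLNM1716, §4 p. 107] -/
theorem symm_mem_selmerGroupOver_iff (y : W.subgroupH1 p H) :
    (coeffH1Equiv p H e χ he hχH).symm y ∈ W'.selmerGroupOver p H ↔ y ∈ W.selmerGroupOver p H := by
  rw [mem_selmerGroupOver_iff_coeffH1Equiv_mem p H e χ he hχH hχ hfin hinf, AddEquiv.apply_symm_apply]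

end Selmer

/-! ## §4 The case `χ = 1`: `K`-isomorphic curves have corresponding Selmer groups over every `L = K̄^H` -/

section VariableChange

variable {K : Type u} [Field K] {W₁ W₂ : WeierstrassCurve K} {V : VariableChange K} (hV : V • W₁ = W₂) (p : ℕ)
  (H : Subgroup (Field.absoluteGaloisGroup K))

/-- `twistPointsIso hV` is `Γ_K`-equivariant, in the `χ = 1` format. [cite: SilvermanAEC2009, X.§4] -/
theorem twistPointsIso_smul_one (σ : Field.absoluteGaloisGroup K) (P : geomPoints W₁) :
    twistPointsIso hV (σ • P) = (fun _ : Field.absoluteGaloisGroup K ↦ (1 : ℤ)) σ • σ • twistPointsIso hV P := by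
  rw [one_zsmul, twistPointsIso_smul]

/-- **`Sel_{p^∞}(W₁/L) ≅ Sel_{p^∞}(W₂/L)` for `K`-isomorphic curves `V • W₁ = W₂` and every `L = K̄^H`** (e.g. the
top of a `ℤ_p`-extension): the tree's `mem_selmerGroupPInfty_iff_h1PrimaryIso_mem` (the case `L = K`) over an
arbitrary normal `H`. [cite: SilvermanAEC2009, X.§4] -/
theorem mem_selmerGroupOver_iff_of_variableChange [NumberField K] [H.Normal] (x : W₁.subgroupH1 p H) :
    x ∈ W₁.selmerGroupOver p H ↔
      coeffH1Equiv p H (twistPointsIso hV) (fun _ ↦ 1) (twistPointsIso_smul_one hV) (fun _ _ ↦ rfl) x ∈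
        W₂.selmerGroupOver p H := by
  refine mem_selmerGroupOver_iff_coeffH1Equiv_mem p H (twistPointsIso hV) (fun _ ↦ 1) (twistPointsIso_smul_one hV)
    (fun _ _ ↦ rfl) (fun _ ↦ Or.inl rfl) (fun v y ↦ ?_) (fun w y ↦ ?_) x
  · exact mem_localKerOver_iff_coeffH1Equiv_mem p H _ _ _ _ (v.adicCompletion K) (twistLocalIso _ hV)
      (fun τ _ Q ↦ twistLocalIso_smul _ hV τ Q) (fun P ↦ pointsMap_twistPointsIso _ hV P) y
  · exact mem_localKerOver_iff_coeffH1Equiv_mem p H _ _ _ _ w.Completion (twistLocalIso _ hV)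
      (fun τ _ Q ↦ twistLocalIso_smul _ hV τ Q) (fun P ↦ pointsMap_twistPointsIso _ hV P) y

end VariableChange

end CoeffTwist

end Literature.NumberTheory.EllipticCurves

end
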